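import Summits.QuantumFields.YangMills.Theorems.FradkinShenkerFlowFiniteSusceptibilityWeakCouplingAxisIsotropy
import Summits.QuantumFields.YangMills.Theorems.FradkinShenkerFlowFiniteSusceptibilityWeakCouplingMirrorDominationAxis0
import Literature.MathematicalPhysics.QuantumFieldTheory.SpeciesTimeReflection
import HarnessLib

/-!
# Selection rule for spatial reflections (item stmt-QuantumFields-9442, line `purity-rate-split`, stub `stub_spatialReflectionSelectionRule`)

Support file for item stmt-QuantumFields-9442 (route `FradkinShenkerFlow` of `YangMills`), crux
`Summit.QuantumFields.YangMills.Theses.FradkinShenkerFlow.FiniteSusceptibilityWeakCoupling`, line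
`purity-rate-split`, stub `stub_spatialReflectionSelectionRule` (strategist §D5 "spatial parity", wave W-A).

**What is proved (every compact `G`, every lattice representation `r`, EVERY coupling `β`).** For a spatial
axis `k ≠ 0` let `θ_k V := configPermZd π (cfgReflect (configPermZd π V))`, `π = Equiv.swap 0 k`, be the
SPATIAL reflection `x_k ↦ -x_k` of a `ℤ⁴` gauge field (links along `k` reversed and inverted), written in tree
vocabulary (the time reflection `cfgReflect` conjugated by the axis transposition). If the species `P` is
`θ_k`-even and the species `M` is `θ_k`-odd, then both connected time-correlations
`latticeConnectedCorr r.ρ β (2S+1) P.F M.F n` and `latticeConnectedCorr r.ρ β (2S+1) M.F P.F n` vanish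
identically, for every odd torus `2S+1` and every time lag `n`.

**Mechanism.** The torus map `Ψ U := configPerm π (Θ' (configPerm π U))` (`Θ' = GaugeConfig.negReflect`)
preserves the torus Wilson state (`wilsonMeasure_map_configPerm`, `measurePreserving_negReflect_wilsonMeasure`;
no sign condition on `β`), its periodic lift is `θ_k` of the periodic lift (`AxisIsotropy.configPermZd_torusLift`,
`torusLift_negReflect`), and `θ_k` commutes with the TIME translations `τ_{-n e₀}` for `k ≠ 0`
(`AxisIsotropy.configPermZd_configShift`, `cfgReflect_configShift`, `σ₀(-n e_k) = -n e_k`). Changing variables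
`U ↦ Ψ U` in `∫ P(Ũ) M(τ Ũ) dμ`, `∫ M(Ũ) P(τ Ũ) dμ` and `∫ M(Ũ) dμ` flips the sign of each integrand, so
each of these integrals vanishes, hence so do both connected correlators. Nothing here is a named fact.
[folklore]
-/

noncomputable section

open MeasureTheory ProbabilityTheory Finset
open Literature.MathematicalPhysics.QuantumFieldTheory hiding Site ZdEdge
open Literature.MathematicalPhysics.QuantumLattice
open Literature.Probability.LatticeModels hiding configShift configShift_apply

namespace Summit.QuantumFields.YangMills.Theorems.FiniteSusceptibilityWeakCoupling

namespace SelectionRule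

/-- The site time reflection `σ₀ : x ↦ (-x₀, x⃗)` fixes every spatial vector `-(c e_k)`, `k ≠ 0`. [folklore] -/
theorem siteReflect_neg_single_of_ne {k : Fin 4} (hk : k ≠ 0) (c : ℤ) :
    siteReflect (-(Pi.single k c) : Site 4) = -(Pi.single k c) := by
  funext j
  rw [MirrorDominationAxis0.siteReflect_apply]
  by_cases hj : j = 0
  · subst hj
    simp [hk.symm]
  · simp [hj]

variable {G : Type} [MeasurableSpace G] [Group G]

/-- **The spatial reflection `θ_k` (`k ≠ 0`) commutes with the time translations**:
`θ_k (τ_{-n e₀} V) = τ_{-n e₀} (θ_k V)`, where `θ_k = configPermZd π ∘ Θ₀ ∘ configPermZd π`,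
`π = Equiv.swap 0 k` (`configPermZd π` conjugates `τ_v` to `τ_{π v}`, `Θ₀` conjugates `τ_w` to `τ_{σ₀ w}`,
and `π (-n e₀) = -n e_k` is fixed by `σ₀`). [folklore] -/
theorem axisReflect_configShift {k : Fin 4} (hk : k ≠ 0) (n : ℤ) (V : LGConfig 4 G) :
    configPermZd (Equiv.swap 0 k) (cfgReflect (configPermZd (Equiv.swap 0 k)
        (configShift (-(Pi.single 0 n)) V))) =
      configShift (-(Pi.single 0 n))
        (configPermZd (Equiv.swap 0 k) (cfgReflect (configPermZd (Equiv.swap 0 k) V))) := by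
  rw [AxisIsotropy.configPermZd_configShift, AxisIsotropy.sitePermZd_neg, sitePermZd_single,
    Equiv.swap_apply_left, MirrorDominationAxis0.cfgReflect_configShift,
    siteReflect_neg_single_of_ne hk, AxisIsotropy.configPermZd_configShift,
    AxisIsotropy.sitePermZd_neg, sitePermZd_single, Equiv.swap_apply_right]

/-- **The periodic lift intertwines the torus map `Ψ = configPerm π ∘ Θ' ∘ configPerm π` with `θ_k`**:
`(Ψ U)~ = θ_k Ũ` (`AxisIsotropy.configPermZd_torusLift` twice and `torusLift_negReflect`). [folklore] -/
theorem torusLift_axisReflect (L : ℕ) (π : Equiv.Perm (Fin 4)) (U : GaugeConfig 4 L G) :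
    torusLift L (configPerm π (GaugeConfig.negReflect (configPerm π U))) =
      configPermZd π (cfgReflect (configPermZd π (torusLift L U))) := by
  rw [AxisIsotropy.configPermZd_torusLift, ← torusLift_negReflect, AxisIsotropy.configPermZd_torusLift]

variable [TopologicalSpace G] [IsTopologicalGroup G] [CompactSpace G] [BorelSpace G]

/-- **`Ψ = configPerm π ∘ Θ' ∘ configPerm π` preserves the torus Wilson state** `wilsonMeasure L r.ρ β`, every
side `L`, every `β` (`wilsonMeasure_map_configPerm`, `measurePreserving_negReflect_wilsonMeasure`). [folklore] -/
theorem measurePreserving_axisReflect (r : LatticeRep G) (β : ℝ) (π : Equiv.Perm (Fin 4)) (L : ℕ)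
    [NeZero L] :
    MeasurePreserving
      (fun U : GaugeConfig 4 L G => configPerm π (GaugeConfig.negReflect (configPerm π U)))
      (wilsonMeasure (d := 4) (L := L) r.ρ β) (wilsonMeasure (d := 4) (L := L) r.ρ β) := by
  have hπ : MeasurePreserving (configPerm π) (wilsonMeasure (d := 4) (L := L) r.ρ β)
      (wilsonMeasure (d := 4) (L := L) r.ρ β) :=
    ⟨(configPerm π).measurable, wilsonMeasure_map_configPerm r.ρ r.continuous β π⟩
  exact hπ.comp ((measurePreserving_negReflect_wilsonMeasure r.ρ r.continuous β).comp hπ)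

/-- **Change of variables `U ↦ Ψ U` under the torus Wilson state**:
`∫ g (Ψ U) dμ = ∫ g dμ` for every real function `g` (`Ψ` is a measure-preserving measurable embedding,
the composite of the measurable equivalences `configPerm π`, `negReflectEquiv`, `configPerm π`). [folklore] -/
theorem integral_comp_axisReflect (r : LatticeRep G) (β : ℝ) (π : Equiv.Perm (Fin 4)) (L : ℕ)
    [NeZero L] (g : GaugeConfig 4 L G → ℝ) :
    ∫ U, g (configPerm π (GaugeConfig.negReflect (configPerm π U)))
        ∂(wilsonMeasure (d := 4) (L := L) r.ρ β) =
      ∫ U, g U ∂(wilsonMeasure (d := 4) (L := L) r.ρ β) :=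
  (measurePreserving_axisReflect r β π L).integral_comp
    ((configPerm π).measurableEmbedding.comp
      ((WilsonSiteRP.negReflectEquiv (d := 4) (L := L) (G := G)).measurableEmbedding.comp
        (configPerm π).measurableEmbedding)) g

/-- **A `Ψ`-odd function has zero mean** under the torus Wilson state: `g ∘ Ψ = -g ⟹ ∫ g dμ = 0`. [folklore] -/
theorem integral_eq_zero_of_axisReflect_odd (r : LatticeRep G) (β : ℝ) (π : Equiv.Perm (Fin 4))
    (L : ℕ) [NeZero L] (g : GaugeConfig 4 L G → ℝ)
    (hg : ∀ U, g (configPerm π (GaugeConfig.negReflect (configPerm π U))) = -g U) :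
    ∫ U, g U ∂(wilsonMeasure (d := 4) (L := L) r.ρ β) = 0 := by
  have h := integral_comp_axisReflect r β π L g
  simp_rw [hg, integral_neg] at h
  linarith

end SelectionRule

/-- **Registered stub `stub_spatialReflectionSelectionRule`** of item stmt-QuantumFields-9442, line
`purity-rate-split` (signature verbatim, fully qualified) — **the selection rule**: for every compact `G`,
every lattice representation `r`, every `β`, every spatial axis `k ≠ 0`, a `θ_k`-even species `P` and a
`θ_k`-odd species `M` have identically vanishing connected time-correlations in both orders, on every odd
torus `2S+1` and at every lag `n` (`θ_k V = configPermZd π (cfgReflect (configPermZd π V))`,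
`π = Equiv.swap 0 k`). Unfold `latticeConnectedCorr`; the three integrals `∫ P(Ũ) M(τŨ)`, `∫ M(Ũ) P(τŨ)`,
`∫ M(Ũ)` have `Ψ`-odd integrands (`SelectionRule.torusLift_axisReflect`,
`SelectionRule.axisReflect_configShift`, the parities) and vanish
(`SelectionRule.integral_eq_zero_of_axisReflect_odd`). [folklore] -/
theorem stub_spatialReflectionSelectionRule : ∀ (G : Type) [Group G] [TopologicalSpace G] [IsTopologicalGroup G] [CompactSpace G] [MeasurableSpace G] [BorelSpace G] (r : Literature.MathematicalPhysics.QuantumFieldTheory.LatticeRep G) (β : ℝ) (k : Fin 4), k ≠ 0 → ∀ P M : Literature.MathematicalPhysics.QuantumFieldTheory.YMSpecies G, (∀ V, P.F (Literature.MathematicalPhysics.QuantumFieldTheory.configPermZd (Equiv.swap 0 k) (Literature.MathematicalPhysics.QuantumFieldTheory.cfgReflect (Literature.MathematicalPhysics.QuantumFieldTheory.configPermZd (Equiv.swap 0 k) V))) = P.F V) → (∀ V, M.F (Literature.MathematicalPhysics.QuantumFieldTheory.configPermZd (Equiv.swap 0 k) (Literature.MathematicalPhysics.QuantumFieldTheory.cfgReflect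 (Literature.MathematicalPhysics.QuantumFieldTheory.configPermZd (Equiv.swap 0 k) V))) = -M.F V) → ∀ S n : ℕ, Literature.MathematicalPhysics.QuantumFieldTheory.latticeConnectedCorr r.ρ β (2 * S + 1) P.F M.F n = 0 ∧ Literature.MathematicalPhysics.QuantumFieldTheory.latticeConnectedCorr r.ρ β (2 * S + 1) M.F P.F n = 0 := by
  intro G _ _ _ _ _ _ r β k hk P M hP hM S n
  have h1 : ∫ U, P.F (torusLift (2 * S + 1) U) *
      M.F (configShift (-Pi.single 0 (n : ℤ)) (torusLift (2 * S + 1) U))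
        ∂(wilsonMeasure (d := 4) (L := 2 * S + 1) r.ρ β) = 0 := by
    refine SelectionRule.integral_eq_zero_of_axisReflect_odd r β (Equiv.swap 0 k) (2 * S + 1) _
      fun U => ?_
    rw [SelectionRule.torusLift_axisReflect, ← SelectionRule.axisReflect_configShift hk, hP, hM]
    ring
  have h2 : ∫ U, M.F (torusLift (2 * S + 1) U) *
      P.F (configShift (-Pi.single 0 (n : ℤ)) (torusLift (2 * S + 1) U))
        ∂(wilsonMeasure (d := 4) (L := 2 * S + 1) r.ρ β) = 0 := by
    refine SelectionRule.integral_eq_zero_of_axisReflect_odd r β (Equiv.swap 0 k) (2 * S + 1) _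
      fun U => ?_
    rw [SelectionRule.torusLift_axisReflect, ← SelectionRule.axisReflect_configShift hk, hM, hP]
    ring
  have h3 : ∫ U, M.F (torusLift (2 * S + 1) U) ∂(wilsonMeasure (d := 4) (L := 2 * S + 1) r.ρ β) = 0 := by
    refine SelectionRule.integral_eq_zero_of_axisReflect_odd r β (Equiv.swap 0 k) (2 * S + 1) _
      fun U => ?_
    rw [SelectionRule.torusLift_axisReflect, hM]
  unfold latticeConnectedCorr
  rw [h1, h2, h3, mul_zero, zero_mul, sub_zero]
  exact ⟨rfl, rfl⟩

end Summit.QuantumFields.YangMills.Theorems.FiniteSusceptibilityWeakCoupling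

end
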